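import Mathlib
import Literature.NumberTheory.Transcendental.LobachevskyPeriodic
import Literature.NumberTheory.Transcendental.IdealTetrahedronSlices
import HarnessLib

/-!
# Milnor's formula `vol T(∞, 0, 1, z) = Л(α) + Л(β) + Л(γ)` — discharge of
# `Milnor1982_idealTetrahedronVolume`

Topic `Literature/NumberTheory/Transcendental`. This file proves the named fact
`Milnor1982_idealTetrahedronVolume` of `BlochWignerDilogarithm.lean` (Milnor 1982, Appendix,
Lemma 2, p. 18: for an ideal hyperbolic 3-simplex with dihedral angles `α, β, γ` at the edges
through one vertex, `α + β + γ = π` and `volume = Л(α) + Л(β) + Л(γ)`), for the tetrahedron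
`T(z)` of the tree (`idealTetrahedron z`, upper half-space model, vertices `∞, 0, 1, z`,
`Im z > 0`, volume element `dx dy dt/t³`), whose dihedral angles at the vertical edges are
`α = arg z`, `β = arg (1 − z)⁻¹`, `γ = arg (1 − z⁻¹)`.

## The proof (Milnor 1982, pp. 19–20, reorganised to avoid the barycentric subdivision)

Milnor integrates `dx dy dt/t³` first in `t` (getting `dx dy/(2H)`, `H` the squared height of
the hemispherical face), then over the six right triangles of the barycentric subdivision of the
triangle `(0, 1, z)` from its circumcentre, each giving `Л(angle)/2` after the substitution
`x = cos θ` and his Lemma 1 ("the case of an obtuse angle can be handled by a similar argument").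
We follow the same computation but slice the triangle `(0, 1, z)` by lines parallel to the edge
`[0, 1]` (`IdealTetrahedronSlices.lean`), which needs no case distinction: with `z = a + bi`,
circumradius `R = |z||z − 1|/(2b)` and `k = (|z|² − a)/b` (so `R sin γ = ½`, `R cos γ = k/2`),

1. `vol T(z) = ∫₀ᵇ I(y) dy`, `I(y) = ∫ dx/(2H) = (1/4ρ) log(((ρ+½)² + y²)/((ρ−½)² + y²))`,
   `ρ = √(¼ + k y − y²)` (Tonelli + the fundamental theorem of calculus; the contributions of the
   two slanted edges combine by the intersecting-chords identity) — `IdealTetrahedronSlices`;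
2. the substitution `y = R cos γ − R cos(γ + 2φ)`, `φ ∈ (0, ψ)`, `ψ = min(α, β)` (the inscribed
   angle parameter; Milnor's `x = cos θ`), under which `ρ = R sin(γ + 2φ)`, `dy = 2ρ dφ`,
   `(ρ ± ½)² + y² = (2R sin(γ + φ))², (2R sin φ)²`, so that the integrand becomes
   `log|2 sin(γ + φ)| − log|2 sin φ|` (`subst_rho_sq`, `subst_dist_sq`, `subst_integrand`);
3. `∫₀^ψ (log|2 sin(γ+φ)| − log|2 sin φ|) dφ = Л(γ) + Л(ψ) − Л(γ + ψ)` (definition of `Л`), and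
   `Л(γ + ψ) = Л(π − max(α, β)) = −Л(max(α, β))` by `α + β + γ = π` and Milnor's Lemma 1 (`Л` odd
   and `π`-periodic, `LobachevskyPeriodic.lean`), giving `Л(α) + Л(β) + Л(γ)`.

The angle facts (`α, β, γ ∈ (0, π)`, `α + β + γ = π`, the sines and cosines in terms of `z`) are
elementary (`arg` of a product as a `Real.Angle`).

## References

* J. Milnor, *Hyperbolic geometry: the first 150 years*, Bull. AMS (N.S.) 6 (1982) 9–24:
  Appendix, Lemma 2 (p. 18) and its proof (pp. 19–20); Lemma 1 (p. 17). [`Milnor1982`]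
-/

noncomputable section

open MeasureTheory Set
open scoped ENNReal

namespace Literature.NumberTheory.Transcendental

/-! ### The substitution `y = R cos γ − R cos (γ + 2φ)` -/

section Subst

variable {k R γ : ℝ}

/-- Under `R sin γ = ½`, `R cos γ = k/2` and `y = R cos γ − R cos(γ + 2φ)`:
`¼ + k y − y² = (R sin(γ + 2φ))²` (the half-chord at height `y` is `R sin(γ + 2φ)`).
[cite: Milnor1982, Appendix, proof of Lemma 2, p. 20 (substitution `A = sin θ, x = cos θ`)] -/
theorem subst_rho_sq (h1 : R * Real.sin γ = 1 / 2) (h2 : R * Real.cos γ = k / 2) (φ : ℝ) :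
    1 / 4 + k * (R * Real.cos γ - R * Real.cos (γ + 2 * φ)) -
        (R * Real.cos γ - R * Real.cos (γ + 2 * φ)) ^ 2 =
      (R * Real.sin (γ + 2 * φ)) ^ 2 := by
  have hk : k = 2 * (R * Real.cos γ) := by linarith
  have h14 : (1 : ℝ) / 4 = (R * Real.sin γ) ^ 2 := by rw [h1]; norm_num
  rw [hk, h14]
  linear_combination (R ^ 2) * Real.sin_sq_add_cos_sq γ -
    (R ^ 2) * Real.sin_sq_add_cos_sq (γ + 2 * φ)

/-- Under `R sin γ = ½` and `y = R cos γ − R cos(γ + 2φ)`, `ρ = R sin(γ + 2φ)`: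
`(ρ + ½)² + y² = (2R sin(γ + φ))²` and `(ρ − ½)² + y² = (2R sin φ)²` (squared distances from the
endpoints of the chord at height `y` to the vertex `1`, as chords of the circumcircle).
[cite: Milnor1982, Appendix, proof of Lemma 2, p. 20] -/
theorem subst_dist_sq (h1 : R * Real.sin γ = 1 / 2) (φ : ℝ) :
    (R * Real.sin (γ + 2 * φ) + 1 / 2) ^ 2 + (R * Real.cos γ - R * Real.cos (γ + 2 * φ)) ^ 2 =
        (2 * R * Real.sin (γ + φ)) ^ 2 ∧
      (R * Real.sin (γ + 2 * φ) - 1 / 2) ^ 2 + (R * Real.cos γ - R * Real.cos (γ + 2 * φ)) ^ 2 =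
        (2 * R * Real.sin φ) ^ 2 := by
  have hs2 : Real.sin (γ + 2 * φ) =
      Real.sin (γ + φ) * Real.cos φ + Real.cos (γ + φ) * Real.sin φ := by
    rw [show γ + 2 * φ = (γ + φ) + φ by ring, Real.sin_add]
  have hs0 : Real.sin γ = Real.sin (γ + φ) * Real.cos φ - Real.cos (γ + φ) * Real.sin φ := by
    rw [show Real.sin γ = Real.sin ((γ + φ) - φ) by ring_nf, Real.sin_sub]
  have hc2 : Real.cos (γ + 2 * φ) =
      Real.cos (γ + φ) * Real.cos φ - Real.sin (γ + φ) * Real.sin φ := by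
    rw [show γ + 2 * φ = (γ + φ) + φ by ring, Real.cos_add]
  have hc0 : Real.cos γ = Real.cos (γ + φ) * Real.cos φ + Real.sin (γ + φ) * Real.sin φ := by
    rw [show Real.cos γ = Real.cos ((γ + φ) - φ) by ring_nf, Real.cos_sub]
  rw [← h1, hs2, hs0, hc2, hc0]
  constructor
  · linear_combination (4 * R ^ 2 * Real.sin (γ + φ) ^ 2) * Real.sin_sq_add_cos_sq φ
  · linear_combination (4 * R ^ 2 * Real.sin φ ^ 2) * Real.sin_sq_add_cos_sq (γ + φ)

/-- The derivative of the substitution: `d/dφ (R cos γ − R cos(γ + 2φ)) = 2R sin(γ + 2φ)`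
(`= 2ρ`). [cite: Milnor1982, Appendix, proof of Lemma 2, p. 20] -/
theorem hasDerivAt_subst (R γ φ : ℝ) :
    HasDerivAt (fun φ => R * Real.cos γ - R * Real.cos (γ + 2 * φ))
      (2 * R * Real.sin (γ + 2 * φ)) φ := by
  have h : HasDerivAt (fun φ => γ + 2 * φ) 2 φ := by
    simpa using ((hasDerivAt_id φ).const_mul 2).const_add γ
  have h' := (h.cos.const_mul R).const_sub (R * Real.cos γ)
  refine h'.congr_deriv ?_
  ring

/-- **The integrand after substitution.** With `y = R cos γ − R cos(γ + 2φ)` the slice value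
`I(y) = (1/4ρ) log(((ρ+½)² + y²)/((ρ−½)² + y²))` times `dy/dφ = 2ρ` is
`log|2 sin(γ + φ)| − log|2 sin φ|` (Milnor 1982, p. 20:
"`¼ ∫ log (2 sin(θ + α))/(2 sin(θ − α)) dθ`").
[cite: Milnor1982, Appendix, proof of Lemma 2, p. 20] -/
theorem subst_integrand (hR : 0 < R) (h1 : R * Real.sin γ = 1 / 2) (h2 : R * Real.cos γ = k / 2)
    {φ : ℝ} (hsφ : 0 < Real.sin φ) (hsγφ : 0 < Real.sin (γ + φ))
    (hs2 : 0 < Real.sin (γ + 2 * φ)) {y : ℝ} (hy : y = R * Real.cos γ - R * Real.cos (γ + 2 * φ)) :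
    2 * R * Real.sin (γ + 2 * φ) * (1 / (4 * Real.sqrt (1 / 4 + k * y - y ^ 2)) *
        Real.log (((Real.sqrt (1 / 4 + k * y - y ^ 2) + 1 / 2) ^ 2 + y ^ 2) /
          ((Real.sqrt (1 / 4 + k * y - y ^ 2) - 1 / 2) ^ 2 + y ^ 2))) =
      Real.log |2 * Real.sin (γ + φ)| - Real.log |2 * Real.sin φ| := by
  have hρ : Real.sqrt (1 / 4 + k * y - y ^ 2) = R * Real.sin (γ + 2 * φ) := by
    rw [hy, subst_rho_sq h1 h2 φ, Real.sqrt_sq (by positivity)]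
  obtain ⟨hE, hF⟩ := subst_dist_sq h1 φ (R := R)
  rw [hρ, hy, hE, hF, Real.log_abs, Real.log_abs,
    Real.log_div (by positivity) (by positivity), Real.log_pow, Real.log_pow,
    show 2 * R * Real.sin (γ + φ) = R * (2 * Real.sin (γ + φ)) by ring,
    show 2 * R * Real.sin φ = R * (2 * Real.sin φ) by ring,
    Real.log_mul hR.ne' (by positivity), Real.log_mul hR.ne' (by positivity)]
  have hρ0 : R * Real.sin (γ + 2 * φ) ≠ 0 := by positivity
  field_simp
  push_cast
  ring

end Subst

/-! ### The outer integral after substitution -/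

/-- For `0 < φ < ψ` with `0 < γ`, `γ + 2ψ ≤ π`: `0 < sin φ < sin (γ + φ)`, so the substituted
integrand `log|2 sin(γ+φ)| − log|2 sin φ|` is nonnegative. [folklore] -/
theorem subst_integrand_nonneg {γ ψ φ : ℝ} (hγ : 0 < γ) (hγψ : γ + 2 * ψ ≤ Real.pi)
    (hφ : φ ∈ Ioo 0 ψ) :
    0 ≤ Real.log |2 * Real.sin (γ + φ)| - Real.log |2 * Real.sin φ| := by
  have hφπ : φ < Real.pi := by linarith [hφ.2, Real.pi_pos]
  have hsφ : 0 < Real.sin φ := Real.sin_pos_of_pos_of_lt_pi hφ.1 hφπ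
  have hdiff : Real.sin (γ + φ) - Real.sin φ =
      2 * Real.sin (γ / 2) * Real.cos ((γ + 2 * φ) / 2) := by
    rw [Real.sin_sub_sin]; ring_nf
  have hφ1 := hφ.1
  have hφ2 := hφ.2
  have h1 : 0 < Real.sin (γ / 2) :=
    Real.sin_pos_of_pos_of_lt_pi (by linarith) (by linarith [Real.pi_pos])
  have h2 : 0 ≤ Real.cos ((γ + 2 * φ) / 2) :=
    Real.cos_nonneg_of_neg_pi_div_two_le_of_le (by linarith [Real.pi_pos]) (by linarith)
  have hle : Real.sin φ ≤ Real.sin (γ + φ) := by nlinarith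
  rw [abs_of_pos (by linarith), abs_of_pos (by linarith), sub_nonneg]
  exact Real.log_le_log (by linarith) (by linarith)

/-- **The `y`-integral of the slice values after Milnor's substitution.** With `R sin γ = ½`,
`R cos γ = k/2`, `0 < γ`, `0 < ψ`, `γ + 2ψ ≤ π` and `R cos γ − R cos(γ + 2ψ) = b`, the map
`φ ↦ y = R cos γ − R cos(γ + 2φ)` is an increasing diffeomorphism `(0, ψ) → (0, b)` and
`∫⁻_{y ∈ (0,b)} ofReal I(y) dy = ofReal ∫_{φ ∈ (0,ψ)} (log|2 sin(γ+φ)| − log|2 sin φ|) dφ`.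
[cite: Milnor1982, Appendix, proof of Lemma 2, p. 20] -/
theorem lintegral_outer_eq {a b k R γ ψ : ℝ} (hb : 0 < b) (hk : b * k = a ^ 2 + b ^ 2 - a)
    (hR : 0 < R) (h1 : R * Real.sin γ = 1 / 2) (h2 : R * Real.cos γ = k / 2) (hγ : 0 < γ)
    (hψ : 0 < ψ) (hγψ : γ + 2 * ψ ≤ Real.pi)
    (hYψ : R * Real.cos γ - R * Real.cos (γ + 2 * ψ) = b) :
    ∫⁻ y in Ioo 0 b, ENNReal.ofReal
        (∫ x in (a * y / b)..(1 + (a - 1) * y / b), 1 / (2 * (x - x ^ 2 - y ^ 2 + k * y))) =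
      ENNReal.ofReal
        (∫ φ in Ioo 0 ψ, (Real.log |2 * Real.sin (γ + φ)| - Real.log |2 * Real.sin φ|)) := by
  set Y : ℝ → ℝ := fun φ => R * Real.cos γ - R * Real.cos (γ + 2 * φ) with hYdef
  have hY0 : Y 0 = 0 := by simp [Y]
  have hYψ' : Y ψ = b := hYψ
  have hmono : StrictMonoOn Y (Icc 0 ψ) := by
    intro φ₁ h₁ φ₂ h₂ hlt
    have : Real.cos (γ + 2 * φ₂) < Real.cos (γ + 2 * φ₁) :=
      Real.cos_lt_cos_of_nonneg_of_le_pi (by linarith [h₁.1]) (by linarith [h₂.2]) (by linarith)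
    simp only [Y]
    nlinarith
  have hcont : ContinuousOn Y (Icc 0 ψ) := by
    apply Continuous.continuousOn
    simp only [Y]
    fun_prop
  have himage : Y '' Ioo 0 ψ = Ioo 0 b := by
    apply Subset.antisymm
    · rintro _ ⟨φ, hφ, rfl⟩
      exact ⟨hY0 ▸ hmono (left_mem_Icc.2 hψ.le) (Ioo_subset_Icc_self hφ) hφ.1,
        hYψ' ▸ hmono (Ioo_subset_Icc_self hφ) (right_mem_Icc.2 hψ.le) hφ.2⟩
    · have h := intermediate_value_Ioo hψ.le hcont
      rwa [hY0, hYψ'] at h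
  have hinj : InjOn Y (Ioo 0 ψ) := (hmono.mono Ioo_subset_Icc_self).injOn
  have hderiv : ∀ φ ∈ Ioo 0 ψ,
      HasDerivWithinAt Y (2 * R * Real.sin (γ + 2 * φ)) (Ioo 0 ψ) φ :=
    fun φ _ => (hasDerivAt_subst R γ φ).hasDerivWithinAt
  rw [← himage, lintegral_image_eq_lintegral_abs_deriv_mul measurableSet_Ioo hderiv hinj]
  have hpt : ∀ φ ∈ Ioo 0 ψ, ENNReal.ofReal |2 * R * Real.sin (γ + 2 * φ)| *
      ENNReal.ofReal (∫ x in (a * Y φ / b)..(1 + (a - 1) * Y φ / b),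
        1 / (2 * (x - x ^ 2 - Y φ ^ 2 + k * Y φ))) =
      ENNReal.ofReal (Real.log |2 * Real.sin (γ + φ)| - Real.log |2 * Real.sin φ|) := by
    intro φ hφ
    have hYmem : Y φ ∈ Ioo 0 b := himage ▸ mem_image_of_mem Y hφ
    have hφπ : φ < Real.pi := by linarith [hφ.2, Real.pi_pos]
    have hsφ : 0 < Real.sin φ := Real.sin_pos_of_pos_of_lt_pi hφ.1 hφπ
    have hsγφ : 0 < Real.sin (γ + φ) :=
      Real.sin_pos_of_pos_of_lt_pi (by linarith [hφ.1]) (by linarith [hφ.2])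
    have hs2 : 0 < Real.sin (γ + 2 * φ) :=
      Real.sin_pos_of_pos_of_lt_pi (by linarith [hφ.1]) (by linarith [hφ.2])
    have hY'pos : 0 ≤ 2 * R * Real.sin (γ + 2 * φ) := by positivity
    rw [abs_of_nonneg hY'pos, ← ENNReal.ofReal_mul hY'pos,
      slice_integral_eq hb hk hYmem.1 hYmem.2, subst_integrand hR h1 h2 hsφ hsγφ hs2 rfl]
  rw [setLIntegral_congr_fun measurableSet_Ioo hpt]
  have hgint : IntervalIntegrable
      (fun φ => Real.log |2 * Real.sin (γ + φ)| - Real.log |2 * Real.sin φ|) volume 0 ψ :=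
    (intervalIntegrable_log_abs_two_mul_sin_add γ 0 ψ).sub
      (intervalIntegrable_log_abs_two_mul_sin 0 ψ)
  have hnn : 0 ≤ᵐ[volume.restrict (Ioo 0 ψ)]
      fun φ => Real.log |2 * Real.sin (γ + φ)| - Real.log |2 * Real.sin φ| := by
    rw [Filter.EventuallyLE, ae_restrict_iff' measurableSet_Ioo]
    exact Filter.Eventually.of_forall fun φ hφ => subst_integrand_nonneg hγ hγψ hφ
  rw [ofReal_integral_eq_lintegral_ofReal (hgint.1.mono_set Ioo_subset_Ioc_self) hnn]

/-- `∫_{(0,ψ)} (log|2 sin(γ+φ)| − log|2 sin φ|) dφ = Л(γ) + Л(ψ) − Л(γ + ψ)` (definition of `Л`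
and additivity; Milnor 1982, p. 20, the displayed evaluation in terms of `Л`).
[cite: Milnor1982, Appendix, proof of Lemma 2, p. 20] -/
theorem integral_subst_integrand_eq {γ ψ : ℝ} (hψ : 0 ≤ ψ) :
    ∫ φ in Ioo 0 ψ, (Real.log |2 * Real.sin (γ + φ)| - Real.log |2 * Real.sin φ|) =
      lobachevsky γ + lobachevsky ψ - lobachevsky (γ + ψ) := by
  rw [← integral_Ioc_eq_integral_Ioo, ← intervalIntegral.integral_of_le hψ,
    intervalIntegral.integral_sub (intervalIntegrable_log_abs_two_mul_sin_add γ 0 ψ)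
      (intervalIntegrable_log_abs_two_mul_sin 0 ψ),
    integral_log_abs_two_mul_sin_add_eq, integral_log_abs_two_mul_sin_eq]
  simp only [add_zero, lobachevsky_zero]
  ring

/-! ### The angles of the triangle `(0, 1, z)` -/

section Angles

/-- `0 < arg w` for `Im w > 0`. [folklore] -/
theorem arg_pos_of_im_pos {w : ℂ} (hw : 0 < w.im) : 0 < Complex.arg w := by
  rcases (Complex.arg_nonneg_iff.mpr hw.le).lt_or_eq with h | h
  · exact h
  · exact absurd (Complex.arg_eq_zero_iff.mp h.symm).2 hw.ne'

/-- `arg w < π` for `Im w > 0`. [folklore] -/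
theorem arg_lt_pi_of_im_pos {w : ℂ} (hw : 0 < w.im) : Complex.arg w < Real.pi :=
  Complex.arg_lt_pi_iff.mpr (Or.inr hw.ne')

variable {z : ℂ}

/-- The angle `β = arg (1 − z)⁻¹` of the triangle `(0, 1, z)` at `1`: it lies in `(0, π)` and
`sin β = Im z/|z − 1|`. [cite: Milnor1982, Appendix, proof of Lemma 2, p. 19] -/
theorem angle_at_one (hz : 0 < z.im) :
    0 < Complex.arg (1 - z)⁻¹ ∧ Complex.arg (1 - z)⁻¹ < Real.pi ∧
      Real.sin (Complex.arg (1 - z)⁻¹) = z.im / ‖z - 1‖ := by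
  have hz1 : 1 - z ≠ 0 := fun h => by
    have := congrArg Complex.im h; simp at this; linarith
  have hN : 0 < Complex.normSq (1 - z) := Complex.normSq_pos.mpr hz1
  have him : ((1 - z)⁻¹).im = z.im / Complex.normSq (1 - z) := by
    rw [Complex.inv_im]; simp
  have himpos : 0 < ((1 - z)⁻¹).im := by rw [him]; positivity
  refine ⟨arg_pos_of_im_pos himpos, arg_lt_pi_of_im_pos himpos, ?_⟩
  rw [Complex.sin_arg, him, norm_inv, Complex.normSq_eq_norm_sq, norm_sub_rev]
  have h0 : ‖z - 1‖ ≠ 0 := by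
    rw [← norm_sub_rev]; exact norm_ne_zero_iff.mpr hz1
  field_simp

/-- The angle `γ = arg (1 − z⁻¹)` of the triangle `(0, 1, z)` at `z`: it lies in `(0, π)`,
`sin γ = Im z/(|z||z − 1|)` and `cos γ = (|z|² − Re z)/(|z||z − 1|)`.
[cite: Milnor1982, Appendix, proof of Lemma 2, p. 19] -/
theorem angle_at_z (hz : 0 < z.im) :
    0 < Complex.arg (1 - z⁻¹) ∧ Complex.arg (1 - z⁻¹) < Real.pi ∧
      Real.sin (Complex.arg (1 - z⁻¹)) = z.im / (‖z‖ * ‖z - 1‖) ∧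
      Real.cos (Complex.arg (1 - z⁻¹)) = (Complex.normSq z - z.re) / (‖z‖ * ‖z - 1‖) := by
  have hz0 : z ≠ 0 := fun h => by simp [h] at hz
  have hz1 : z - 1 ≠ 0 := fun h => by
    have := congrArg Complex.im h; simp at this; linarith
  have hN : 0 < Complex.normSq z := Complex.normSq_pos.mpr hz0
  have hw : 1 - z⁻¹ = (z - 1) / z := by field_simp
  have hw0 : 1 - z⁻¹ ≠ 0 := by rw [hw]; exact div_ne_zero hz1 hz0
  have him : (1 - z⁻¹).im = z.im / Complex.normSq z := by
    simp [Complex.inv_im, neg_div]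
  have hre : (1 - z⁻¹).re = 1 - z.re / Complex.normSq z := by
    simp [Complex.inv_re]
  have hnorm : ‖1 - z⁻¹‖ = ‖z - 1‖ / ‖z‖ := by rw [hw, norm_div]
  have himpos : 0 < (1 - z⁻¹).im := by rw [him]; positivity
  have hn0 : ‖z‖ ≠ 0 := norm_ne_zero_iff.mpr hz0
  have hn1 : ‖z - 1‖ ≠ 0 := norm_ne_zero_iff.mpr hz1
  have hNeq : Complex.normSq z = ‖z‖ ^ 2 := Complex.normSq_eq_norm_sq z
  refine ⟨arg_pos_of_im_pos himpos, arg_lt_pi_of_im_pos himpos, ?_, ?_⟩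
  · rw [Complex.sin_arg, him, hnorm, hNeq]
    field_simp
  · rw [Complex.cos_arg hw0, hre, hnorm, hNeq]
    field_simp

/-- **The angles of the Euclidean triangle `(0, 1, z)` add up to `π`**:
`arg z + arg (1 − z)⁻¹ + arg (1 − z⁻¹) = π` for `Im z > 0` (Milnor 1982, Lemma 2:
"`α + β + γ = π`"). Proof: the product `z · (1 − z)⁻¹ · (1 − z⁻¹) = −1` has argument `π`, the sum
of the three arguments as a `Real.Angle`, and the sum lies in `(0, 3π)`.
[cite: Milnor1982, Appendix, Lemma 2, p. 18] -/
theorem angle_sum (hz : 0 < z.im) :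
    Complex.arg z + Complex.arg (1 - z)⁻¹ + Complex.arg (1 - z⁻¹) = Real.pi := by
  have hz0 : z ≠ 0 := fun h => by simp [h] at hz
  have hz1 : 1 - z ≠ 0 := fun h => by
    have := congrArg Complex.im h; simp at this; linarith
  have hz1' : z - 1 ≠ 0 := fun h => by
    have := congrArg Complex.im h; simp at this; linarith
  have hw1 : (1 - z)⁻¹ ≠ 0 := inv_ne_zero hz1
  have hw : 1 - z⁻¹ = (z - 1) / z := by field_simp
  have hw2 : 1 - z⁻¹ ≠ 0 := by rw [hw]; exact div_ne_zero hz1' hz0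
  have hprod : z * (1 - z)⁻¹ * (1 - z⁻¹) = -1 := by
    rw [hw]
    field_simp
    ring
  have hangle : ((Complex.arg z + Complex.arg (1 - z)⁻¹ + Complex.arg (1 - z⁻¹) : ℝ) :
      Real.Angle) = (Real.pi : ℝ) := by
    rw [← Complex.arg_neg_one, ← hprod, Complex.arg_mul_coe_angle (mul_ne_zero hz0 hw1) hw2,
      Complex.arg_mul_coe_angle hz0 hw1, Real.Angle.coe_add, Real.Angle.coe_add]
  rw [Real.Angle.angle_eq_iff_two_pi_dvd_sub] at hangle
  obtain ⟨n, hn⟩ := hangle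
  have hα := arg_pos_of_im_pos hz
  have hα' := arg_lt_pi_of_im_pos hz
  obtain ⟨hβ, hβ', -⟩ := angle_at_one hz
  obtain ⟨hγ, hγ', -⟩ := angle_at_z hz
  have hlo : (-1 : ℝ) < 2 * n := by nlinarith [Real.pi_pos]
  have hhi : (2 * n : ℝ) < 2 := by nlinarith [Real.pi_pos]
  have hn0 : n = 0 := by
    have h1 : (-1 : ℤ) < 2 * n := by exact_mod_cast hlo
    have h2 : 2 * n < (2 : ℤ) := by exact_mod_cast hhi
    omega
  subst hn0
  simp at hn
  linarith

end Angles

/-! ### Milnor's Lemma 2 for `T(∞, 0, 1, z)` -/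

/-- **Milnor's volume formula, discharged**: for `Im z > 0` the hyperbolic volume of the ideal
tetrahedron with vertices `∞, 0, 1, z` is `Л(α) + Л(β) + Л(γ)` with `α = arg z`,
`β = arg (1 − z)⁻¹`, `γ = arg (1 − z⁻¹)` its dihedral angles at the edges through `∞`
(Milnor 1982, Appendix, Lemma 2, p. 18; proof pp. 19–20). This proves the tree's named fact
`Milnor1982_idealTetrahedronVolume`. [cite: Milnor1982, Appendix, Lemma 2, p. 18] -/
theorem Milnor1982_idealTetrahedronVolume_holds : Milnor1982_idealTetrahedronVolume := by
  intro z hz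
  -- notation
  set α := Complex.arg z with hαdef
  set β := Complex.arg (1 - z)⁻¹ with hβdef
  set γ := Complex.arg (1 - z⁻¹) with hγdef
  have hz0 : z ≠ 0 := fun h => by simp [h] at hz
  have hz1 : z - 1 ≠ 0 := fun h => by
    have := congrArg Complex.im h; simp at this; linarith
  have hn0 : 0 < ‖z‖ := norm_pos_iff.mpr hz0
  have hn1 : 0 < ‖z - 1‖ := norm_pos_iff.mpr hz1
  have hα : 0 < α := arg_pos_of_im_pos hz
  have hα' : α < Real.pi := arg_lt_pi_of_im_pos hz
  have hsinα : Real.sin α = z.im / ‖z‖ := Complex.sin_arg z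
  obtain ⟨hβ, hβ', hsinβ⟩ := angle_at_one hz
  obtain ⟨hγ, hγ', hsinγ, hcosγ⟩ := angle_at_z hz
  have hsum : α + β + γ = Real.pi := angle_sum hz
  -- the parameters `k`, `R`, `ψ`
  set b := z.im with hbdef
  set a := z.re with hadef
  set k := (a ^ 2 + b ^ 2 - a) / b with hkdef
  have hk : b * k = a ^ 2 + b ^ 2 - a := by rw [hkdef]; field_simp
  have hNsq : Complex.normSq z = a ^ 2 + b ^ 2 := by rw [Complex.normSq_apply]; ring
  set R := ‖z‖ * ‖z - 1‖ / (2 * b) with hRdef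
  have hR : 0 < R := by positivity
  have h1 : R * Real.sin γ = 1 / 2 := by
    rw [hsinγ, hRdef]; field_simp
  have h2 : R * Real.cos γ = k / 2 := by
    rw [hcosγ, hRdef, hkdef, hNsq]; field_simp
  set ψ := min α β with hψdef
  have hψ : 0 < ψ := lt_min hα hβ
  have hγψ : γ + 2 * ψ ≤ Real.pi := by
    have := min_le_left α β; have := min_le_right α β; linarith
  have hss : 2 * R * Real.sin α * Real.sin β = b := by
    rw [hsinα, hsinβ, hRdef]; field_simp
  have hYψ : R * Real.cos γ - R * Real.cos (γ + 2 * ψ) = b := by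
    have hγeq : γ = Real.pi - (α + β) := by linarith
    rcases le_total α β with hab | hab
    · have hψα : ψ = α := min_eq_left hab
      rw [hψα, hγeq, show Real.pi - (α + β) + 2 * α = (α - β) + Real.pi by ring,
        Real.cos_add_pi, Real.cos_pi_sub, Real.cos_add, Real.cos_sub]
      linarith
    · have hψβ : ψ = β := min_eq_right hab
      rw [hψβ, hγeq, show Real.pi - (α + β) + 2 * β = (β - α) + Real.pi by ring,
        Real.cos_add_pi, Real.cos_pi_sub, Real.cos_add, Real.cos_sub]
      linarith
  -- assemble
  rw [idealTetrahedronVolume_eq_lintegral_slice hz hk, lintegral_outer_eq hz hk hR h1 h2 hγ hψ hγψ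
    hYψ, integral_subst_integrand_eq hψ.le, ENNReal.toReal_ofReal]
  · -- bookkeeping with `Л` odd and `π`-periodic
    have hmax : γ + ψ = Real.pi - max α β := by
      have := min_add_max α β; linarith
    rw [hmax, lobachevsky_pi_sub]
    rcases le_total α β with hab | hab
    · rw [hψdef, min_eq_left hab, max_eq_right hab]; ring
    · rw [hψdef, min_eq_right hab, max_eq_left hab]; ring
  · rw [← integral_subst_integrand_eq hψ.le]
    exact setIntegral_nonneg measurableSet_Ioo fun φ hφ => subst_integrand_nonneg hγ hγψ hφ

end Literature.NumberTheory.Transcendental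

end
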